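import Mathlib
import HarnessLib
import Summits.ValiantsHypothesis.ValiantsHypothesis.Theorems.LacunarySymmetroidMatrixDescartesOsculationLawTwoKSupport

/-!
# ValiantsHypothesis / LacunarySymmetroid — crux `MatrixDescartes` (stmt-ValiantsHypothesis-18050, V1),
# line `Cruxes/MatrixDescartes/Lines/osculation_law.lean` («osculation-law»): MONOMIAL COUNTS for the rank-two column

Support bookkeeping for the `(2, s)` splittings (every `s`): if `supp a ⊆ s•E`, `supp m ⊆ (s+1)•E`,
`supp δ ⊆ (s+2)•E` (the coefficients of the rank-two letter `a·b² + m·b + δ`, determinants / cofactors of an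
`(s+2) × (s+2)` pencil with exponent set `E`), then the pseudo-remainder pair `U, V` of
`OsculationCuspGen.hess_reduce_poly` (p605555) — BIHOMOGENEOUS: total degree `7`, `(1,2,3)`-weight `12`, `13` — and
`N = a·V² − m·U·V + δ·U²` (degree `15`, weight `27`) satisfy

  `supp U ⊆ (7s+5)•E`,  `supp V ⊆ (7s+6)•E`,  `supp N ⊆ (15s+12)•E`,

and the rank-one resultant for the degenerate branch `a ≡ 0` has `supp(W(δ)·m² − W(m)·δ²) ⊆ (4s+6)•E`
(`θ = X·d/dX` weightless).  The monomial-by-monomial terms below were generated mechanically from the tree's own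
texts of `U`, `V` and are checked here by the kernel (`OsculationCusp.supp_*` algebra of `…TwoKSupport`).
Honest framing: arithmetic bookkeeping for located columns of an UNREGISTERED V1 law line; nothing here bears on
`OsculationLaw`, `MatrixDescartes`, Conjecture B or `VP ≠ VNP`.  No definitions, no named facts; Mathlib only.
-/

-- `Summit.ValiantsHypothesis.ValiantsHypothesis.…` is the tree's mandated single-conjunct layout (Sub = Summit).
set_option linter.dupNamespace false

noncomputable section

namespace Summit.ValiantsHypothesis.ValiantsHypothesis.Theorems.LacunarySymmetroidMatrixDescartes

open Polynomial
open scoped BigOperators Pointwise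

namespace OsculationRankTwo

open OsculationCusp

/-- `supp U ⊆ (7s + 5) • E` (every monomial of `U` has `a`-, `m`-, `δ`-degrees `(i, j, k)` with `i + j + k = 7`,
`i + 2j + 3k = 12`, hence weight `s·7 + 5`). [folklore] -/
theorem supp_U_gen (a m δ : ℝ[X]) (E : Finset ℕ) (s : ℕ) (ha : a.support ⊆ s • E) (hm : m.support ⊆ (s + 1) • E)
    (hδ : δ.support ⊆ (s + 2) • E) :
    ((4 : ℝ[X]) * a ^ 4 * m * δ * (X * derivative (X * derivative δ)) - (3 : ℝ[X]) * a ^ 4 * m * (X * derivative δ) ^ 2 + (4 : ℝ[X]) * a ^ 4 * δ ^ 2 * (X * derivative (X * derivative m)) - (4 : ℝ[X]) * a ^ 4 * δ * (X * derivative m) * (X * derivative δ) - a ^ 3 * m ^ 3 * (X * derivative (X * derivative δ)) - (5 : ℝ[X]) * a ^ 3 * m ^ 2 * δ * (X * derivative (X * derivative m)) + (4 : ℝ[X]) * a ^ 3 * m ^ 2 * (X * derivative m) * (X * derivative δ) - (8 : ℝ[X]) * a ^ 3 * m * δ ^ 2 * (X * derivative (X * derivative a)) + (2 : ℝ[X])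 * a ^ 3 * m * δ * (X * derivative a) * (X * derivative δ) + a ^ 3 * m * δ * (X * derivative m) ^ 2 - (4 : ℝ[X]) * a ^ 3 * δ ^ 2 * (X * derivative a) * (X * derivative m) + a ^ 2 * m ^ 4 * (X * derivative (X * derivative m)) + (6 : ℝ[X]) * a ^ 2 * m ^ 3 * δ * (X * derivative (X * derivative a)) - (2 : ℝ[X]) * a ^ 2 * m ^ 3 * (X * derivative a) * (X * derivative δ) - a ^ 2 * m ^ 3 * (X * derivative m) ^ 2 + (4 : ℝ[X]) * a ^ 2 * m ^ 2 * δ * (X * derivative a) * (X * derivative m) + (9 : ℝ[X]) * a ^ 2 * m * δ ^ 2 * (X * derivative a) ^ 2 - a * m ^ 5 * (X * derivative (X * derivative a)) - (7 : ℝ[X]) * a * m ^ 3 * δ * (X * derivative a) ^ 2 + m ^ 5 * (X * derivative a) ^ 2).support ⊆ (7 * s + 5) • E := by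
  exact supp_add (supp_sub (supp_sub (supp_add (supp_add (supp_sub (supp_sub (supp_add (supp_add (supp_sub (supp_add (supp_add (supp_sub (supp_add (supp_sub (supp_sub (supp_sub (supp_add (supp_sub (supp_cast (supp_mul (supp_mul (supp_mul (supp_ofNat_mul 4 (supp_pow ha 4 (by norm_num))) (hm)) (hδ)) (supp_theta (supp_theta hδ))) (by ring)) (supp_cast (supp_mul (supp_mul (supp_ofNat_mul 3 (supp_pow ha 4 (by norm_num))) (hm)) (supp_pow (supp_theta hδ) 2 (by norm_num))) (by ring))) (supp_cast (supp_mul (supp_mul (supp_ofNat_mul 4 (supp_pow ha 4 (by norm_num))) (supp_pow hδ 2 (by norm_num))) (supp_theta (supp_theta hm))) (by ring))) (supp_cast (supp_mul (supp_mul (supp_mul (supp_ofNat_mul 4 (supp_pow ha 4 (by norm_num))) (hδ)) (supp_theta hm)) (supp_theta hδ)) (by ring))) (supp_cast (supp_mul (supp_mul (supp_pow ha 3 (by norm_num)) (supp_pow hm 3 (by norm_num))) (supp_theta (supp_theta hδ))) (by ring))) (supp_cast (supp_mul (supp_mul (supp_mul (supp_ofNat_mul 5 (supp_pow ha 3 (by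 norm_num))) (supp_pow hm 2 (by norm_num))) (hδ)) (supp_theta (supp_theta hm))) (by ring))) (supp_cast (supp_mul (supp_mul (supp_mul (supp_ofNat_mul 4 (supp_pow ha 3 (by norm_num))) (supp_pow hm 2 (by norm_num))) (supp_theta hm)) (supp_theta hδ)) (by ring))) (supp_cast (supp_mul (supp_mul (supp_mul (supp_ofNat_mul 8 (supp_pow ha 3 (by norm_num))) (hm)) (supp_pow hδ 2 (by norm_num))) (supp_theta (supp_theta ha))) (by ring))) (supp_cast (supp_mul (supp_mul (supp_mul (supp_mul (supp_ofNat_mul 2 (supp_pow ha 3 (by norm_num))) (hm)) (hδ)) (supp_theta ha)) (supp_theta hδ)) (by ring))) (supp_cast (supp_mul (supp_mul (supp_mul (supp_pow ha 3 (by norm_num)) (hm)) (hδ)) (supp_pow (supp_theta hm) 2 (by norm_num))) (by ring))) (supp_cast (supp_mul (supp_mul (supp_mul (supp_ofNat_mul 4 (supp_pow ha 3 (by norm_num))) (supp_pow hδ 2 (by norm_num))) (supp_theta ha)) (supp_theta hm)) (by ring))) (supp_cast (supp_mul (supp_mul (supp_pow ha 2 (by norm_num)) (supp_pow hm 4 (by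 norm_num))) (supp_theta (supp_theta hm))) (by ring))) (supp_cast (supp_mul (supp_mul (supp_mul (supp_ofNat_mul 6 (supp_pow ha 2 (by norm_num))) (supp_pow hm 3 (by norm_num))) (hδ)) (supp_theta (supp_theta ha))) (by ring))) (supp_cast (supp_mul (supp_mul (supp_mul (supp_ofNat_mul 2 (supp_pow ha 2 (by norm_num))) (supp_pow hm 3 (by norm_num))) (supp_theta ha)) (supp_theta hδ)) (by ring))) (supp_cast (supp_mul (supp_mul (supp_pow ha 2 (by norm_num)) (supp_pow hm 3 (by norm_num))) (supp_pow (supp_theta hm) 2 (by norm_num))) (by ring))) (supp_cast (supp_mul (supp_mul (supp_mul (supp_mul (supp_ofNat_mul 4 (supp_pow ha 2 (by norm_num))) (supp_pow hm 2 (by norm_num))) (hδ)) (supp_theta ha)) (supp_theta hm)) (by ring))) (supp_cast (supp_mul (supp_mul (supp_mul (supp_ofNat_mul 9 (supp_pow ha 2 (by norm_num))) (hm)) (supp_pow hδ 2 (by norm_num))) (supp_pow (supp_theta ha) 2 (by norm_num))) (by ring))) (supp_cast (supp_mul (supp_mul (ha) (supp_pow hm 5 (by norm_num))) (supp_theta (supp_theta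 ha))) (by ring))) (supp_cast (supp_mul (supp_mul (supp_mul (supp_ofNat_mul 7 (ha)) (supp_pow hm 3 (by norm_num))) (hδ)) (supp_pow (supp_theta ha) 2 (by norm_num))) (by ring))) (supp_cast (supp_mul (supp_pow hm 5 (by norm_num)) (supp_pow (supp_theta ha) 2 (by norm_num))) (by ring))

/-- `supp V ⊆ (7s + 6) • E` (degrees `7`, weight `13`). [folklore] -/
theorem supp_V_gen (a m δ : ℝ[X]) (E : Finset ℕ) (s : ℕ) (ha : a.support ⊆ s • E) (hm : m.support ⊆ (s + 1) • E)
    (hδ : δ.support ⊆ (s + 2) • E) :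
    ((4 : ℝ[X]) * a ^ 4 * δ ^ 2 * (X * derivative (X * derivative δ)) - (4 : ℝ[X]) * a ^ 4 * δ * (X * derivative δ) ^ 2 - a ^ 3 * m ^ 2 * δ * (X * derivative (X * derivative δ)) - (4 : ℝ[X]) * a ^ 3 * m * δ ^ 2 * (X * derivative (X * derivative m)) + (4 : ℝ[X]) * a ^ 3 * m * δ * (X * derivative m) * (X * derivative δ) - (4 : ℝ[X]) * a ^ 3 * δ ^ 3 * (X * derivative (X * derivative a)) + a ^ 2 * m ^ 3 * δ * (X * derivative (X * derivative m)) + (5 : ℝ[X]) * a ^ 2 * m ^ 2 * δ ^ 2 * (X * derivative (X * derivative a)) - (2 : ℝ[X]) * a ^ 2 * m ^ 2 * δ * (X * derivative a) * (X * derivative δ) - a ^ 2 * m ^ 2 * δ * (X * derivative m) ^ 2 + (4 : ℝ[X]) * a ^ 2 * m * δ ^ 2 * (X * derivative a) * (X * derivative m) + (4 : ℝ[X]) * a ^ 2 * δ ^ 3 * (X * derivative a) ^ 2 - a * m ^ 4 * δ * (X * derivative (X * derivative a)) - (6 : ℝ[X]) * a * m ^ 2 * δ ^ 2 * (X * derivative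 a) ^ 2 + m ^ 4 * δ * (X * derivative a) ^ 2).support ⊆ (7 * s + 6) • E := by
  exact supp_add (supp_sub (supp_sub (supp_add (supp_add (supp_sub (supp_sub (supp_add (supp_add (supp_sub (supp_add (supp_sub (supp_sub (supp_sub (supp_cast (supp_mul (supp_mul (supp_ofNat_mul 4 (supp_pow ha 4 (by norm_num))) (supp_pow hδ 2 (by norm_num))) (supp_theta (supp_theta hδ))) (by ring)) (supp_cast (supp_mul (supp_mul (supp_ofNat_mul 4 (supp_pow ha 4 (by norm_num))) (hδ)) (supp_pow (supp_theta hδ) 2 (by norm_num))) (by ring))) (supp_cast (supp_mul (supp_mul (supp_mul (supp_pow ha 3 (by norm_num)) (supp_pow hm 2 (by norm_num))) (hδ)) (supp_theta (supp_theta hδ))) (by ring))) (supp_cast (supp_mul (supp_mul (supp_mul (supp_ofNat_mul 4 (supp_pow ha 3 (by norm_num))) (hm)) (supp_pow hδ 2 (by norm_num))) (supp_theta (supp_theta hm))) (by ring))) (supp_cast (supp_mul (supp_mul (supp_mul (supp_mul (supp_ofNat_mul 4 (supp_pow ha 3 (by norm_num))) (hm)) (hδ)) (supp_theta hm)) (supp_theta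 hδ)) (by ring))) (supp_cast (supp_mul (supp_mul (supp_ofNat_mul 4 (supp_pow ha 3 (by norm_num))) (supp_pow hδ 3 (by norm_num))) (supp_theta (supp_theta ha))) (by ring))) (supp_cast (supp_mul (supp_mul (supp_mul (supp_pow ha 2 (by norm_num)) (supp_pow hm 3 (by norm_num))) (hδ)) (supp_theta (supp_theta hm))) (by ring))) (supp_cast (supp_mul (supp_mul (supp_mul (supp_ofNat_mul 5 (supp_pow ha 2 (by norm_num))) (supp_pow hm 2 (by norm_num))) (supp_pow hδ 2 (by norm_num))) (supp_theta (supp_theta ha))) (by ring))) (supp_cast (supp_mul (supp_mul (supp_mul (supp_mul (supp_ofNat_mul 2 (supp_pow ha 2 (by norm_num))) (supp_pow hm 2 (by norm_num))) (hδ)) (supp_theta ha)) (supp_theta hδ)) (by ring))) (supp_cast (supp_mul (supp_mul (supp_mul (supp_pow ha 2 (by norm_num)) (supp_pow hm 2 (by norm_num))) (hδ)) (supp_pow (supp_theta hm) 2 (by norm_num))) (by ring))) (supp_cast (supp_mul (supp_mul (supp_mul (supp_mul (supp_ofNat_mul 4 (supp_pow ha 2 (by norm_num))) (hm)) (supp_pow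 hδ 2 (by norm_num))) (supp_theta ha)) (supp_theta hm)) (by ring))) (supp_cast (supp_mul (supp_mul (supp_ofNat_mul 4 (supp_pow ha 2 (by norm_num))) (supp_pow hδ 3 (by norm_num))) (supp_pow (supp_theta ha) 2 (by norm_num))) (by ring))) (supp_cast (supp_mul (supp_mul (supp_mul (ha) (supp_pow hm 4 (by norm_num))) (hδ)) (supp_theta (supp_theta ha))) (by ring))) (supp_cast (supp_mul (supp_mul (supp_mul (supp_ofNat_mul 6 (ha)) (supp_pow hm 2 (by norm_num))) (supp_pow hδ 2 (by norm_num))) (supp_pow (supp_theta ha) 2 (by norm_num))) (by ring))) (supp_cast (supp_mul (supp_mul (supp_pow hm 4 (by norm_num)) (hδ)) (supp_pow (supp_theta ha) 2 (by norm_num))) (by ring))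

-- the statement carries `U` (twice) and `V` (twice): elaboration alone is slow.
set_option maxHeartbeats 1600000 in
/-- `supp N ⊆ (15s + 12) • E` for `N = a·V² − m·U·V + δ·U²`. [folklore] -/
theorem supp_N_gen (a m δ : ℝ[X]) (E : Finset ℕ) (s : ℕ) (ha : a.support ⊆ s • E) (hm : m.support ⊆ (s + 1) • E)
    (hδ : δ.support ⊆ (s + 2) • E) :
    (a * ((4 : ℝ[X]) * a ^ 4 * δ ^ 2 * (X * derivative (X * derivative δ)) - (4 : ℝ[X]) * a ^ 4 * δ * (X * derivative δ) ^ 2 - a ^ 3 * m ^ 2 * δ * (X * derivative (X * derivative δ)) - (4 : ℝ[X]) * a ^ 3 * m * δ ^ 2 * (X * derivative (X * derivative m)) + (4 : ℝ[X]) * a ^ 3 * m * δ * (X * derivative m) * (X * derivative δ) - (4 : ℝ[X]) * a ^ 3 * δ ^ 3 * (X * derivative (X * derivative a)) + a ^ 2 * m ^ 3 * δ * (X * derivative (X * derivative m)) + (5 : ℝ[X]) * a ^ 2 * m ^ 2 * δ ^ 2 * (X * derivative (X * derivative a)) - (2 : ℝ[X]) * a ^ 2 * m ^ 2 * δ * (X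 * derivative a) * (X * derivative δ) - a ^ 2 * m ^ 2 * δ * (X * derivative m) ^ 2 + (4 : ℝ[X]) * a ^ 2 * m * δ ^ 2 * (X * derivative a) * (X * derivative m) + (4 : ℝ[X]) * a ^ 2 * δ ^ 3 * (X * derivative a) ^ 2 - a * m ^ 4 * δ * (X * derivative (X * derivative a)) - (6 : ℝ[X]) * a * m ^ 2 * δ ^ 2 * (X * derivative a) ^ 2 + m ^ 4 * δ * (X * derivative a) ^ 2) ^ 2 - m * ((4 : ℝ[X]) * a ^ 4 * m * δ * (X * derivative (X * derivative δ)) - (3 : ℝ[X]) * a ^ 4 * m * (X * derivative δ) ^ 2 + (4 : ℝ[X]) * a ^ 4 * δ ^ 2 * (X * derivative (X * derivative m)) - (4 : ℝ[X]) * a ^ 4 * δ * (X * derivative m) * (X * derivative δ) - a ^ 3 * m ^ 3 * (X * derivative (X * derivative δ)) - (5 : ℝ[X]) * a ^ 3 * m ^ 2 * δ * (X * derivative (X * derivative m)) + (4 : ℝ[X]) * a ^ 3 * m ^ 2 * (X * derivative m) * (X * derivative δ) - (8 : ℝ[X]) * a ^ 3 * m * δ ^ 2 * (X * derivative (X * derivative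 a)) + (2 : ℝ[X]) * a ^ 3 * m * δ * (X * derivative a) * (X * derivative δ) + a ^ 3 * m * δ * (X * derivative m) ^ 2 - (4 : ℝ[X]) * a ^ 3 * δ ^ 2 * (X * derivative a) * (X * derivative m) + a ^ 2 * m ^ 4 * (X * derivative (X * derivative m)) + (6 : ℝ[X]) * a ^ 2 * m ^ 3 * δ * (X * derivative (X * derivative a)) - (2 : ℝ[X]) * a ^ 2 * m ^ 3 * (X * derivative a) * (X * derivative δ) - a ^ 2 * m ^ 3 * (X * derivative m) ^ 2 + (4 : ℝ[X]) * a ^ 2 * m ^ 2 * δ * (X * derivative a) * (X * derivative m) + (9 : ℝ[X]) * a ^ 2 * m * δ ^ 2 * (X * derivative a) ^ 2 - a * m ^ 5 * (X * derivative (X * derivative a)) - (7 : ℝ[X]) * a * m ^ 3 * δ * (X * derivative a) ^ 2 + m ^ 5 * (X * derivative a) ^ 2) * ((4 : ℝ[X]) * a ^ 4 * δ ^ 2 * (X * derivative (X * derivative δ)) - (4 : ℝ[X]) * a ^ 4 * δ * (X * derivative δ) ^ 2 - a ^ 3 * m ^ 2 * δ * (X * derivative (X * derivative δ)) - (4 :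 ℝ[X]) * a ^ 3 * m * δ ^ 2 * (X * derivative (X * derivative m)) + (4 : ℝ[X]) * a ^ 3 * m * δ * (X * derivative m) * (X * derivative δ) - (4 : ℝ[X]) * a ^ 3 * δ ^ 3 * (X * derivative (X * derivative a)) + a ^ 2 * m ^ 3 * δ * (X * derivative (X * derivative m)) + (5 : ℝ[X]) * a ^ 2 * m ^ 2 * δ ^ 2 * (X * derivative (X * derivative a)) - (2 : ℝ[X]) * a ^ 2 * m ^ 2 * δ * (X * derivative a) * (X * derivative δ) - a ^ 2 * m ^ 2 * δ * (X * derivative m) ^ 2 + (4 : ℝ[X]) * a ^ 2 * m * δ ^ 2 * (X * derivative a) * (X * derivative m) + (4 : ℝ[X]) * a ^ 2 * δ ^ 3 * (X * derivative a) ^ 2 - a * m ^ 4 * δ * (X * derivative (X * derivative a)) - (6 : ℝ[X]) * a * m ^ 2 * δ ^ 2 * (X * derivative a) ^ 2 + m ^ 4 * δ * (X * derivative a) ^ 2) + δ * ((4 : ℝ[X]) * a ^ 4 * m * δ * (X * derivative (X * derivative δ)) - (3 : ℝ[X]) * a ^ 4 * m * (X * derivative δ) ^ 2 + (4 : ℝ[X])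 * a ^ 4 * δ ^ 2 * (X * derivative (X * derivative m)) - (4 : ℝ[X]) * a ^ 4 * δ * (X * derivative m) * (X * derivative δ) - a ^ 3 * m ^ 3 * (X * derivative (X * derivative δ)) - (5 : ℝ[X]) * a ^ 3 * m ^ 2 * δ * (X * derivative (X * derivative m)) + (4 : ℝ[X]) * a ^ 3 * m ^ 2 * (X * derivative m) * (X * derivative δ) - (8 : ℝ[X]) * a ^ 3 * m * δ ^ 2 * (X * derivative (X * derivative a)) + (2 : ℝ[X]) * a ^ 3 * m * δ * (X * derivative a) * (X * derivative δ) + a ^ 3 * m * δ * (X * derivative m) ^ 2 - (4 : ℝ[X]) * a ^ 3 * δ ^ 2 * (X * derivative a) * (X * derivative m) + a ^ 2 * m ^ 4 * (X * derivative (X * derivative m)) + (6 : ℝ[X]) * a ^ 2 * m ^ 3 * δ * (X * derivative (X * derivative a)) - (2 : ℝ[X]) * a ^ 2 * m ^ 3 * (X * derivative a) * (X * derivative δ) - a ^ 2 * m ^ 3 * (X * derivative m) ^ 2 + (4 : ℝ[X]) * a ^ 2 * m ^ 2 * δ * (X * derivative a) * (X * derivative m) + (9 : ℝ[X]) * a ^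 2 * m * δ ^ 2 * (X * derivative a) ^ 2 - a * m ^ 5 * (X * derivative (X * derivative a)) - (7 : ℝ[X]) * a * m ^ 3 * δ * (X * derivative a) ^ 2 + m ^ 5 * (X * derivative a) ^ 2) ^ 2).support ⊆ (15 * s + 12) • E := by
  have hU := supp_U_gen a m δ E s ha hm hδ
  have hV := supp_V_gen a m δ E s ha hm hδ
  exact supp_add (supp_sub (supp_cast (supp_mul ha (supp_pow hV 2 (by norm_num))) (by ring))
    (supp_cast (supp_mul (supp_mul hm hU) hV) (by ring)))
    (supp_cast (supp_mul hδ (supp_pow hU 2 (by norm_num))) (by ring))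

/-- `supp (W(f)·g² − W(g)·f²) ⊆ (4s + 6) • E` for `supp f ⊆ (s+2)•E`, `supp g ⊆ (s+1)•E` (the rank-one resultant of
`OsculationRankOne.osc_ncard_le` on the branch `a ≡ 0`, where the letter is `Φ = ι δ + X₁·ι m`). [folklore] -/
theorem supp_R_gen (f g : ℝ[X]) (E : Finset ℕ) (s : ℕ) (hf : f.support ⊆ (s + 2) • E) (hg : g.support ⊆ (s + 1) • E) :
    ((f * (X * derivative (X * derivative f)) - (X * derivative f) ^ 2) * g ^ 2 - (g * (X * derivative (X * derivative g)) - (X * derivative g) ^ 2) * f ^ 2).support ⊆ (4 * s + 6) • E := by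
  have hf1 := supp_theta hf
  have hf2 := supp_theta hf1
  have hg1 := supp_theta hg
  have hg2 := supp_theta hg1
  exact supp_sub (supp_cast (supp_mul (supp_sub (supp_mul hf hf2) (supp_cast (supp_pow hf1 2 (by norm_num)) (by ring)))
      (supp_pow hg 2 (by norm_num))) (by ring))
    (supp_cast (supp_mul (supp_sub (supp_mul hg hg2) (supp_cast (supp_pow hg1 2 (by norm_num)) (by ring)))
      (supp_pow hf 2 (by norm_num))) (by ring))

/-- Power bookkeeping: `K^i ≤ K^j` for `1 ≤ i ≤ j` (also at `K = 0`). [folklore] -/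
theorem pow_le_pow_of_le' (K : ℕ) {i j : ℕ} (h1 : 1 ≤ i) (hij : i ≤ j) : K ^ i ≤ K ^ j := by
  rcases Nat.eq_zero_or_pos K with hK | hK
  · subst hK; rw [zero_pow (by omega), zero_pow (by omega)]
  · exact Nat.pow_le_pow_right hK hij

/-- The final arithmetic of the rank-two column. [folklore] -/
theorem column_arith (K s : ℕ) :
    K ^ (15 * s + 12) + 2 * K ^ (7 * s + 5) + 2 * K ^ (7 * s + 6) ≤ 5 * K ^ (15 * s + 12) ∧
      K ^ (4 * s + 6) ≤ 5 * K ^ (15 * s + 12) := by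
  have h1 := pow_le_pow_of_le' K (i := 7 * s + 5) (j := 15 * s + 12) (by omega) (by omega)
  have h2 := pow_le_pow_of_le' K (i := 7 * s + 6) (j := 15 * s + 12) (by omega) (by omega)
  have h3 := pow_le_pow_of_le' K (i := 4 * s + 6) (j := 15 * s + 12) (by omega) (by omega)
  constructor <;> omega

end OsculationRankTwo

end Summit.ValiantsHypothesis.ValiantsHypothesis.Theorems.LacunarySymmetroidMatrixDescartes
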